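import Summits.MatrixMultiplication.MatrixMultiplication.Theorems.AbelianSTPPCensusVPCertSound

/-!
# vP certificate: from the tree statement of crux `ShapeExclusionVP337` to the `VPCert` checker (transport)

`VPCert.shapeExclusionVP_of_checkV : checkV M = true → M ≤ 337 → 2 ≤ N → SieveAdmissibleVP M a b c → ¬ Beats (5/2) M a b c`
and the range form `VPCert.shapeExclusionVP_range` (the shape of the registered stubs `stub_vp_128_207` / `stub_vp_208_337` of
stmt-MatrixMultiplication-19191): the Δ5 Eval files need only supply `checkV M = true` per order.  Ingredients: eng-2's bridge
(`GM`, `admM_GM`, `inUniv_shp`), the vP bridge and heredity of p440210 (`u11GM_of_le` / `u11PM_of_le`), the Δ1 gains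
(`rpow_le_gain337`, p432306) and `VPCert.checkV_sound`.
Cell mm-stpp, seat mm-stpp-vp-p2 (gen 0), 2026-08-26.
-/

set_option linter.dupNamespace false
set_option autoImplicit false


namespace Summit.MatrixMultiplication.MatrixMultiplication.Theorems.VPCert

open ShapeCert

variable {N M : ℕ} (a b c : Fin N → ℕ)

/-- a beating family has Δ1 integer gain above `10⁶·M` (orders `M ≤ 337`) -/
theorem beats_gsum337 (hS : SieveAdmissible M a b c) (hM : M ≤ 337) (hB : Beats (5 / 2) M a b c) :
    M * D < gsum337 (GM a b c) := by
  unfold Beats at hB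
  have hV : ∀ i, shapeVol a b c i ≤ 337 := fun i => by
    unfold SieveAdmissible at hS; dsimp only at hS; exact (hS.1 i).2.2.2.trans hM
  have hsum : (M : ℝ) < ∑ i, ((gainOf337 (shapeVol a b c i) : ℝ) / 1000000) :=
    hB.trans_le (Finset.sum_le_sum fun i _ => rpow_le_gain337 _ (hV i))
  rw [← Finset.sum_div, lt_div_iff₀ (by norm_num)] at hsum
  have h2 : M * 1000000 < ∑ i, gainOf337 (shapeVol a b c i) := by exact_mod_cast hsum
  unfold gsum337 D; rw [sum_GM]; exact h2

/-- **Crux `ShapeExclusionVP337` at one order from the certificate.** If `checkV M = true` (`M ≤ 337`), every shape list with at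
least two members that is vP-admissible at order `M` fails to beat `5/2`. -/
theorem shapeExclusionVP_of_checkV (h : checkV M = true) (hM : M ≤ 337) (hN : 2 ≤ N)
    (hVP : SieveAdmissibleVP M a b c) : ¬ Beats (5 / 2) M a b c := fun hB =>
  checkV_sound h (GM a b c)
    (fun x hx => by obtain ⟨i, rfl⟩ := (mem_GM a b c).mp hx; exact inUniv_shp a b c hN hVP.1 i)
    (admM_GM a b c hN hVP.1)
    (fun L hL => ⟨u11GM_of_le a b c hVP.1 hVP.2.1 hL, fun hp => u11PM_of_le a b c hVP.1 (hVP.2.2 hp) hL⟩)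
    (beats_gsum337 a b c hVP.1 hM hB)

/-- **Range form** (the shape of the registered stubs): certificates on `[lo, hi]` with `hi ≤ 337` give the crux on that range. -/
theorem shapeExclusionVP_range {lo hi : ℕ} (hhi : hi ≤ 337) (hc : ∀ M, lo ≤ M → M ≤ hi → checkV M = true) :
    ∀ (N M : ℕ) (a b c : Fin N → ℕ), 2 ≤ N → lo ≤ M → M ≤ hi → SieveAdmissibleVP M a b c → ¬ Beats (5 / 2) M a b c :=
  fun _ M a b c hN h1 h2 hVP => shapeExclusionVP_of_checkV a b c (hc M h1 h2) (h2.trans hhi) hN hVP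

end Summit.MatrixMultiplication.MatrixMultiplication.Theorems.VPCert
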